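import Literature.AnabelianGeometry.EtaleTheta.SettingModelCyclotomicCharacter
import Literature.AnabelianGeometry.EtaleTheta.CyclotomeZHatEquiv
import Literature.AnabelianGeometry.EtaleTheta.ZHatLevelDetermination
import Literature.NumberTheory.GaloisRepresentations.RootsOfUnityInverseLimit
import Mathlib.Topology.Instances.ZMod
import HarnessLib

/-!
# `Ẑ` with the cyclotomic character IS the Tate module `Ẑ(1)(K̄) = lim_n μ_n(K̄)`: a topological, Galois-equivariant
# identification through a compatible system of primitive roots (module side of the «κ from clause (1)» chain; proof-only)

Classical: for a `p`-adic field `K ⊆ ℚ̄_p` and a `K`-isomorphism `ι : K^al ≅ ℚ̄_p`, the choice of a compatible system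
`ξ = (ξ_n)_n` of primitive roots of unity in `K^al` identifies `Ẑ = lim_n ℤ/nℤ` with `Ẑ(1)(K^al) = lim_n μ_n(K^al)`,
`z ↦ (ξ_n ^ (z mod n))_n`, and under this identification `τ ∈ Gal(K^al/K)` acts by the cyclotomic character `χ(σ)` of any
`σ ∈ G_{ℚ_p}` inducing `τ` through `ι` [cite: NeukirchSchmidtWingberg2008, II §7 Thm 2.7.5]; Mochizuki, *The étale theta
function …* [EtTh] §1 p. 13 (`G_K` acts on `μ_N` through the cyclotomic character) [cite: MochizukiEtTh2009, §1 p.13];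
[GalSect] §4 p. 33 «`I_x ≅ Ẑ(1)`» [cite: MochizukiGalSect2005, §4 p.33].  abc-iut cell, layer L2, seat abc-iut-w5-d051
(gen 5); ROWS #73 R600 (B), file B2.  PROOF-ONLY (no definition, no instance, no named fact): the identification is produced
inside an `∃`.

* `GalSect.continuous_zHatLevel` — the level characters `Ẑ → ℤ/nℤ` are continuous (open kernel, `ZHatLevel.isOpen_ker_level`);
* **`GalSect.exists_zHat_continuousAddEquiv_tateModule K ι`** — `∃ T : Additive Ẑ ≃ₜ+ Ẑ(1)(K^al)` (`(muSystem K).limit`, the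
  carrier of abc-iut-L4's `tateModuleMu K`) such that for every `σ ∈ G_{ℚ_p}` and `τ ∈ Gal(K^al/K)` with `ι (τ • y) = σ • ι y`:
  `T (χ(σ) z) = τ • T z` (`SettingModel.chi`, abc-iut-w5-d091; the action of `tateModuleMu`).  Ingredients BY NAME:
  `cyclotome.exists_generator` (a compatible system of primitive roots), `ZHatLevel.level` / `toAdd_level_aut` /
  `LevelFamily.powEnd` / `ext_of_level` (abc-iut-w4-d024 / this lane's `ZHatLevelDetermination`),
  `SettingModel.apply_eq_pow_levelChar_chi` (`σ(μ) = μ ^ χ_N(σ)`), `muOfUnit` / `muVal` (abc-iut-L4).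

HONEST FRAMING: classical statements, OUR kernel check; nothing here bears on [IUTchIII] Cor. 3.12; no side is taken.
-/

noncomputable section

namespace Literature.AnabelianGeometry.EtaleTheta

namespace GalSect

open CategoryTheory ProfiniteGrp ProfiniteGrp.ProfiniteCompletion Field
open Literature.NumberTheory.GaloisRepresentations Literature.NumberTheory.GaloisRepresentations.DiscreteGaloisModule
open Literature.AnabelianGeometry.SemiGraphs (GQp)

variable (p : ℕ) [Fact p.Prime]

/-- **The level characters `Ẑ → ℤ/nℤ` are continuous** (discrete target): every fibre is a coset of the OPEN kernel
(`ZHatLevel.isOpen_ker_level`). [cite: RibesZalesskii2010, Thm 2.7.1] -/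
theorem continuous_zHatLevel (n : ℕ+) : Continuous (ZHatLevel.level n) := by
  refine continuous_discrete_rng.2 fun b => ?_
  by_cases hb : ∃ x, ZHatLevel.level n x = b
  · obtain ⟨x, rfl⟩ := hb
    have hset : ZHatLevel.level n ⁻¹' {ZHatLevel.level n x} =
        (fun y => x * y) '' ((ZHatLevel.level n).ker : Set (completion (GrpCat.of (Multiplicative ℤ)))) := by
      ext y
      simp only [Set.mem_preimage, Set.mem_singleton_iff, Set.mem_image, SetLike.mem_coe, MonoidHom.mem_ker]
      constructor
      · intro hy
        refine ⟨x⁻¹ * y, by rw [map_mul, map_inv, hy, inv_mul_cancel], by rw [mul_inv_cancel_left]⟩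
      · rintro ⟨k, hk, rfl⟩
        rw [map_mul, hk, mul_one]
    rw [hset]
    exact (Homeomorph.mulLeft x).isOpenMap _ (ZHatLevel.isOpen_ker_level n)
  · have hset : ZHatLevel.level n ⁻¹' {b} = ∅ :=
      Set.eq_empty_iff_forall_notMem.2 fun y hy => hb ⟨y, hy⟩
    rw [hset]
    exact isOpen_empty

/-- Powers of a unit killed by `n` only depend on the exponent mod `n` (restated for readability).
[cite: RibesZalesskii2010, Thm 2.7.1] -/
private theorem pow_eq_pow_of_mod_eq {M : Type*} [Monoid M] {a : M} {n : ℕ} (ha : a ^ n = 1) {k l : ℕ}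
    (h : k % n = l % n) : a ^ k = a ^ l := by
  rw [pow_eq_pow_mod k ha, pow_eq_pow_mod l ha, h]

/-- **`Ẑ` with the cyclotomic character ≅ `Ẑ(1)(K^al)` topologically and Galois-equivariantly.**  For a `p`-adic field
`K ⊆ ℚ̄_p` (an intermediate field of `ℚ̄_p/ℚ_p`) and a `K`-isomorphism `ι : K^al ≃ₐ[K] ℚ̄_p` there is an isomorphism of
topological abelian groups `T : Additive Ẑ ≃ₜ+ Ẑ(1)(K^al) = lim_n μ_n(K^al)` (levelwise `z ↦ ξ_n ^ (z mod n)` for a compatible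
system of primitive roots `ξ`) such that for all `σ ∈ G_{ℚ_p}`, `τ ∈ Gal(K^al/K)` with `ι (τ • y) = σ • ι y` (all `y ∈ K^al`):
`T (χ(σ) · z) = τ • (T z)` — the Galois action on the Tate module, read in `Ẑ`, IS the cyclotomic character.
[cite: NeukirchSchmidtWingberg2008, II §7 Thm 2.7.5] -/
theorem exists_zHat_continuousAddEquiv_tateModule (K : IntermediateField ℚ_[p] (PadicAlgCl p))
    (ι : AlgebraicClosure K ≃ₐ[K] PadicAlgCl p) :
    ∃ T : Additive (completion (GrpCat.of (Multiplicative ℤ))) ≃ₜ+ (muSystem K).limit,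
      ∀ (σ : GQp p) (τ : absoluteGaloisGroup K),
        (∀ y : AlgebraicClosure K, ι (τ • y) = σ • ι y) →
          ∀ z : completion (GrpCat.of (Multiplicative ℤ)),
            T (Additive.ofMul (SettingModel.chi p σ z)) =
              (tateModuleMu K).toTopRep.ρ τ (T (Additive.ofMul z)) := by
  classical
  haveI : CharZero K := charZero_of_injective_algebraMap (algebraMap ℚ_[p] K).injective
  haveI : CharZero (AlgebraicClosure K) :=
    charZero_of_injective_algebraMap (algebraMap K (AlgebraicClosure K)).injective
  -- a compatible system of primitive roots of unity in `K^al`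
  obtain ⟨ξ, hξ⟩ := cyclotome.exists_generator
    (cyclotome.exists_isPrimitiveRoot_of_isSepClosed (AlgebraicClosure K))
  -- notation: the level-`n` exponent of `z ∈ Ẑ`
  let ex : ∀ n : ℕ+, completion (GrpCat.of (Multiplicative ℤ)) → ℕ := fun n z =>
    (Multiplicative.toAdd (ZHatLevel.level n z)).val
  have hex_lt : ∀ (n : ℕ+) z, ex n z < (n : ℕ) := fun n z => by
    haveI : NeZero (n : ℕ) := ⟨n.ne_zero⟩
    exact ZMod.val_lt _
  have hξpow : ∀ (n : ℕ+) (k : ℕ), ((ξ : ℕ+ → (AlgebraicClosure K)ˣ) n ^ k) ^ ((n : ℕ+) : ℕ) = 1 :=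
    fun n k => by rw [← pow_mul, mul_comm, pow_mul, cyclotome.pow_eq_one, one_pow]
  -- the level-`n` coordinate
  let crd : ∀ n : ℕ+, completion (GrpCat.of (Multiplicative ℤ)) → MuCarrier K n := fun n z =>
    muOfUnit K n ((ξ : ℕ+ → (AlgebraicClosure K)ˣ) n ^ ex n z) (hξpow n (ex n z))
  have muVal_crd : ∀ (n : ℕ+) z, muVal K n (crd n z) = (ξ : ℕ+ → (AlgebraicClosure K)ˣ) n ^ ex n z :=
    fun n z => rfl
  -- compatibility along divisibility
  have hcompat : ∀ z ⦃n m : ℕ+⦄ (h : (muSystem K).le n m), (muSystem K).red h (crd m z) = crd n z := by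
    intro z n m h
    obtain ⟨d, rfl⟩ : ∃ d : ℕ+, m = n * d := PNat.dvd_iff.2 h
    apply muVal_injective K n
    rw [muSystem_red, muVal_muPowMap, muVal_crd, muVal_crd, PNat.mul_coe, Nat.mul_div_cancel_left _ n.pos,
      ← pow_mul, mul_comm (ex (n * d) z) ((d : ℕ+) : ℕ), pow_mul, cyclotome.pow_apply_mul]
    refine pow_eq_pow_of_mod_eq (cyclotome.pow_eq_one ξ n) ?_
    rw [Nat.mod_eq_of_lt (hex_lt n z)]
    exact (ZHatLevel.LevelFamily.ofZHat z).val_mod (dvd_mul_right (n : ℕ) d)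
  -- the map `Ẑ → Ẑ(1)(K^al)`
  let T₀ : completion (GrpCat.of (Multiplicative ℤ)) → (muSystem K).limit := fun z => ⟨fun n => crd n z, hcompat z⟩
  have T₀_apply : ∀ z (n : ℕ+), ((T₀ z : (muSystem K).limit) : ∀ n : ℕ+, MuCarrier K n) n = crd n z := fun z n => rfl
  -- multiplicative ↦ additive
  have T₀_mul : ∀ z w, T₀ (z * w) = T₀ z + T₀ w := by
    intro z w
    refine Subtype.ext (funext fun n => muVal_injective K n ?_)
    haveI : NeZero ((n : ℕ+) : ℕ) := ⟨n.ne_zero⟩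
    change muVal K n (crd n (z * w)) = muVal K n (crd n z + crd n w)
    rw [muVal_add, muVal_crd, muVal_crd, muVal_crd, ← pow_add]
    refine pow_eq_pow_of_mod_eq (cyclotome.pow_eq_one ξ n) ?_
    change (Multiplicative.toAdd (ZHatLevel.level n (z * w))).val % (n : ℕ) = _
    rw [map_mul, toAdd_mul, ZMod.val_add, Nat.mod_mod]
  have T₀_one : T₀ 1 = 0 := by
    have h := T₀_mul 1 1
    rw [mul_one] at h
    have h' : T₀ 1 + T₀ 1 = T₀ 1 + 0 := by rw [add_zero]; exact h.symm
    exact add_left_cancel h'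
  -- continuity
  have T₀_cont : Continuous T₀ := by
    refine continuous_induced_rng.2 (continuous_pi fun n => ?_)
    change Continuous fun z => crd n z
    have hfac : (fun z => crd n z) = (fun b : Multiplicative (ZMod n) =>
        muOfUnit K n ((ξ : ℕ+ → (AlgebraicClosure K)ˣ) n ^ (Multiplicative.toAdd b).val)
          (hξpow n (Multiplicative.toAdd b).val)) ∘ ZHatLevel.level n := rfl
    rw [hfac]
    exact continuous_of_discreteTopology.comp (continuous_zHatLevel n)
  -- injectivity
  have T₀_inj : Function.Injective T₀ := by
    intro z w h
    refine ZHatLevel.ext_of_level fun n => ?_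
    haveI : NeZero ((n : ℕ+) : ℕ) := ⟨n.ne_zero⟩
    have hn : muVal K n (crd n z) = muVal K n (crd n w) := by
      rw [← T₀_apply z n, ← T₀_apply w n, h]
    rw [muVal_crd, muVal_crd] at hn
    have hmod : ex n z ≡ ex n w [MOD (n : ℕ)] := by
      have h' := pow_eq_pow_iff_modEq.mp hn
      rwa [← (hξ n).eq_orderOf] at h'
    rw [Nat.ModEq, Nat.mod_eq_of_lt (hex_lt n z), Nat.mod_eq_of_lt (hex_lt n w)] at hmod
    exact Multiplicative.toAdd.injective (ZMod.val_injective _ hmod)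
  -- surjectivity: discrete logarithms to the base `ξ` form a compatible family
  have T₀_surj : Function.Surjective T₀ := by
    intro y
    have hdl : ∀ n : ℕ+, ∃ i < (n : ℕ),
        (ξ : ℕ+ → (AlgebraicClosure K)ˣ) n ^ i = muVal K n ((y : ∀ n : ℕ+, MuCarrier K n) n) := fun n => by
      haveI : NeZero ((n : ℕ+) : ℕ) := ⟨n.ne_zero⟩
      have hprim : IsPrimitiveRoot ((((ξ : ℕ+ → (AlgebraicClosure K)ˣ) n) : (AlgebraicClosure K)ˣ) :
          AlgebraicClosure K) (n : ℕ) := (hξ n).map_of_injective Units.coeHom_injective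
      obtain ⟨i, hi, h⟩ := hprim.eq_pow_of_pow_eq_one
        (ξ := ((muVal K n ((y : ∀ n : ℕ+, MuCarrier K n) n) : (AlgebraicClosure K)ˣ) : AlgebraicClosure K))
        (by rw [← Units.val_pow_eq_pow_val, muVal_pow_eq_one, Units.val_one])
      exact ⟨i, hi, Units.ext (by rw [Units.val_pow_eq_pow_val]; exact h)⟩
    choose i hi_lt hi using hdl
    have hi_mod : ∀ (n N : ℕ+), ((n : ℕ) ∣ N) → i N % (n : ℕ) = i n := by
      intro n N h
      obtain ⟨d, rfl⟩ : ∃ d : ℕ+, N = n * d := PNat.dvd_iff.2 h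
      have hy := congrArg (muVal K n) ((muSystem K).red_apply_coe y
        (show (muSystem K).le n (n * d) from dvd_mul_right (n : ℕ) d))
      rw [muSystem_red, muVal_muPowMap, ← hi (n * d), ← hi n, PNat.mul_coe, Nat.mul_div_cancel_left _ n.pos,
        ← pow_mul, mul_comm (i (n * d)) ((d : ℕ+) : ℕ), pow_mul, cyclotome.pow_apply_mul] at hy
      have hmod : i (n * d) ≡ i n [MOD (n : ℕ)] := by
        have h' := pow_eq_pow_iff_modEq.mp hy
        rwa [← (hξ n).eq_orderOf] at h'
      rw [Nat.ModEq, Nat.mod_eq_of_lt (hi_lt n)] at hmod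
      exact hmod
    let c : ZHatLevel.LevelFamily :=
      { c := fun n => (i n : ZMod n)
        compat := fun n N h => by
          haveI : NeZero ((N : ℕ+) : ℕ) := ⟨N.ne_zero⟩
          rw [map_natCast]
          exact (ZMod.natCast_eq_natCast_iff _ _ _).2 (by
            rw [Nat.ModEq, hi_mod n N h, Nat.mod_eq_of_lt (hi_lt n)]) }
    refine ⟨ZHatLevel.powEnd c (ZHatLevel.eta 1), Subtype.ext (funext fun n => muVal_injective K n ?_)⟩
    haveI : NeZero ((n : ℕ+) : ℕ) := ⟨n.ne_zero⟩
    rw [T₀_apply, muVal_crd, ← hi n]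
    congr 1
    change (Multiplicative.toAdd (ZHatLevel.level n (ZHatLevel.powEnd c (ZHatLevel.eta 1)))).val = i n
    rw [ZHatLevel.toAdd_level_powEnd, ZHatLevel.level_eta, toAdd_ofAdd, Int.cast_one, mul_one]
    change ((i n : ℕ) : ZMod n).val = i n
    rw [ZMod.val_natCast, Nat.mod_eq_of_lt (hi_lt n)]
  -- the topological isomorphism (compact source, Hausdorff target)
  let Tadd : Additive (completion (GrpCat.of (Multiplicative ℤ))) →+ (muSystem K).limit :=
    { toFun := fun a => T₀ (Additive.toMul a)
      map_zero' := T₀_one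
      map_add' := fun a b => T₀_mul (Additive.toMul a) (Additive.toMul b) }
  have Tadd_apply : ∀ z, Tadd (Additive.ofMul z) = T₀ z := fun z => rfl
  have Tadd_bij : Function.Bijective Tadd :=
    ⟨fun a b h => Additive.toMul.injective (T₀_inj h), fun y => by
      obtain ⟨z, hz⟩ := T₀_surj y
      exact ⟨Additive.ofMul z, hz⟩⟩
  have Tadd_cont : Continuous Tadd := T₀_cont
  let E : Additive (completion (GrpCat.of (Multiplicative ℤ))) ≃+ (muSystem K).limit := AddEquiv.ofBijective Tadd Tadd_bij
  have hE : Continuous E := Tadd_cont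
  refine ⟨{ E with
    continuous_toFun := hE
    continuous_invFun := Continuous.continuous_symm_of_equiv_compact_to_t2 (f := E.toEquiv) hE }, ?_⟩
  -- equivariance: `T (χ(σ) z) = τ • T z`
  intro σ τ hτ z
  change T₀ (SettingModel.chi p σ z) = (tateModuleMu K).toTopRep.ρ τ (T₀ z)
  refine Subtype.ext (funext fun n => muVal_injective K n (Units.ext (ι.injective ?_)))
  haveI : NeZero ((n : ℕ+) : ℕ) := ⟨n.ne_zero⟩
  -- left: `ξ_n ^ ((χ_n(σ) · level_n z).val)`; right: `τ • ξ_n ^ (level_n z).val`, read through `ι`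
  have hR : muVal K n ((((tateModuleMu K).toTopRep.ρ τ (T₀ z) : (muSystem K).limit) : ∀ n : ℕ+, MuCarrier K n) n) =
      τ • ((ξ : ℕ+ → (AlgebraicClosure K)ˣ) n ^ ex n z) := rfl
  have hμ : (ι ((((ξ : ℕ+ → (AlgebraicClosure K)ˣ) n) : (AlgebraicClosure K)ˣ) : AlgebraicClosure K)) ^
      ((n : ℕ+) : ℕ) = 1 := by
    rw [← map_pow, ← Units.val_pow_eq_pow_val, cyclotome.pow_eq_one, Units.val_one, map_one]
  rw [T₀_apply, muVal_crd, hR, Units.val_pow_eq_pow_val, map_pow, Units.coe_smul, hτ, Units.val_pow_eq_pow_val,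
    map_pow, AlgEquiv.smul_def, map_pow, SettingModel.apply_eq_pow_levelChar_chi p σ n hμ, ← pow_mul]
  refine pow_eq_pow_of_mod_eq hμ ?_
  change (Multiplicative.toAdd (ZHatLevel.level n (SettingModel.chi p σ z))).val % (n : ℕ) = _
  rw [ZHatLevel.toAdd_level_aut, ZMod.val_mul, Nat.mod_mod]

end GalSect

end Literature.AnabelianGeometry.EtaleTheta

end
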